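import Summits.QuantumFields.YangMills.Theses.QuantileBitPurity
import Summits.QuantumFields.YangMills.Theorems.QuantileBitPurityFluxSuppression
import Summits.QuantumFields.YangMills.Theorems.QuantileBitPurityFluxWideBand
import Summits.QuantumFields.YangMills.Theorems.QuantileBitPuritySectors
import HarnessLib

/-!
# `QuantileBitPurity.EquatorBandVanishing` (item stmt-QuantumFields-24093) — PROVED by flux reflection

Route `QuantileBitPurity` crux h₂ (rank 4): THE EQUATOR BAND IS NEGLIGIBLE — for every core exponent `0 < γc ≤ 2/5` and every `ε > 0` there are
`a = γc/160`, `β₀`, `L₀ = 2` such that for `β ≥ β₀` and every `2 ≤ L ≤ β^a` the zero-flux thermal weight of the slice-`0` band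
`{2 − β^(−γc) ≤ polDist}` on the `L`-ring is `≤ ε · Z_phys(L)`.

METHOD (seat ym-dw-p1 g17, modules `Theorems/QuantileBitPurityFlux*`).  Sector decomposition of the ring trace
(`TT.ringInsTrace_indicator_zero_eq_sum_sectorWeight`: eight `(ℤ/2)³` seam sectors, each weight `≥ 0`).
* The four sectors WITH `x`-twist (`z 0 = true`) — the physical slice marginal AT the equator — are small IN TOTAL: FLUX REFLECTION
  (`Flux.sectorWeight_twisted_le_rpow_odd/_even`): the twisted weight is a pairing of two gauge-averaged half rings, the sign bit `sign Re tr P_x` is odd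
  under the twist, Cauchy–Schwarz in the positive form of the transfer kernel bounds it by `3√W_0(1)√W_0(thin band) + bad fields`, and the thin band
  `{|Re tr P_x| ≤ 8L²β^(−19/40)}` is `O(β^(−a/2))·Z_phys` by the own-axis translate estimate at the equator; total `≤ 13β^(−a/2)·Z_phys`.
* The four sectors WITHOUT `x`-twist: the wide band `{2 − β^(−γc) ≤ polDist}` is an own-axis strip about the equator (`f ≡ 2`, core radius `1`, floor `1/4`)
  of width `β^(−γc)`; `⌈64eβ^(γc/40)⌉` disjoint angular translates of step `6β^(−γc)` cost `O(1)` each (`Flux.sectorWeight_wideBand_le_rpow`, WIDE numerics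
  `η = β^(−(1/2−γc/4))`): `≤ β^(−γc/40)·Z_phys`.
Both rates are `≤ ε` for `β ≥ β₀(γc, ε)`.

HONEST FRAMING: one crux (h₂) of route `QuantileBitPurity`; h₁ `HolonomyQuantileSubQuartic` ⟨24091⟩ is NOT touched here; a fixed-lattice estimate uniform
on the window `L ≤ β^(γc/160)`; nothing about infinite volume, the continuum limit or the Clay Yang–Mills gap — the YM mass gap is NOT proved.  No `sorry`,
no new axiom, no new definition.  References: [cite: tHooft1979]; [cite: Luscher1983, §2]; [cite: MontvayMunster1994, (3.145)].
-/

set_option autoImplicit false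

noncomputable section

open MeasureTheory Set Function Real
open scoped BigOperators
open Literature.MathematicalPhysics.QuantumLattice
open Literature.MathematicalPhysics.QuantumFieldTheory hiding SU2
open Summit.QuantumFields.YangMills.Theorems
open Summit.QuantumFields.YangMills.Theorems.FemtoTransferGap
open Summit.QuantumFields.YangMills.Theorems.FemtoTransferGap.TT
open Summit.QuantumFields.YangMills.Theorems.FemtoTransferGap.FlatSheet
open Summit.QuantumFields.YangMills.Theorems.FemtoTransferGap.OwnAxis

namespace Summit.QuantumFields.YangMills.Theorems.QuantileBitPurity

/-- ★ **`QuantileBitPurity.EquatorBandVanishing` holds** (item stmt-QuantumFields-24093, BY NAME): the wide equator band `{2 − β^(−γc) ≤ polDist}` carries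
at most `ε · Z_phys(L)` of the zero-flux thermal weight on the window `2 ≤ L ≤ β^(γc/160)`, `β ≥ β₀(γc, ε)`.  Flux reflection for the `x`-twisted sectors,
the own-axis class shift at the equator for the others.  The Yang–Mills mass gap is NOT proved. [cite: tHooft1979] [cite: Luscher1983, §2]
[cite: MontvayMunster1994, (3.145)] -/
theorem equatorBandVanishing_proof : Summit.QuantumFields.YangMills.Theses.QuantileBitPurity.EquatorBandVanishing := by
  intro γc hγc hγc' ε hε
  have ha : 0 < γc / 160 := by positivity
  have ha' : γc / 160 ≤ 1 / 400 := by linarith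
  obtain ⟨βe, he⟩ := Flux.sectorWeight_twisted_le_rpow_even (a := γc / 160) ha ha'
  obtain ⟨βo, ho⟩ := Flux.sectorWeight_twisted_le_rpow_odd (a := γc / 160) ha ha'
  obtain ⟨βw, hw⟩ := Flux.sectorWeight_wideBand_le_rpow (γ := γc) hγc hγc'
  refine ⟨γc / 160, ha, max (max βe βo) (max βw (max (200 : ℝ) (max ((13 / ε) ^ (1 / (-(-(γc / 160 / 2)))))
    ((1 / ε) ^ (1 / (-(-(γc / 40)))))))), 2, fun β hβ L _ hL2 hLa => ?_⟩
  -- the thresholds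
  have hβe : βe ≤ β := le_trans (le_trans (le_max_left _ _) (le_max_left _ _)) hβ
  have hβo : βo ≤ β := le_trans (le_trans (le_max_right _ _) (le_max_left _ _)) hβ
  have hβ' : max βw (max (200 : ℝ) (max ((13 / ε) ^ (1 / (-(-(γc / 160 / 2))))) ((1 / ε) ^ (1 / (-(-(γc / 40))))))) ≤ β :=
    le_trans (le_max_right _ _) hβ
  have hβw : βw ≤ β := le_trans (le_max_left _ _) hβ'
  have h200 : (200 : ℝ) ≤ β := le_trans (le_trans (le_max_left _ _) (le_max_right _ _)) hβ'
  have hT1 : (13 / ε) ^ (1 / (-(-(γc / 160 / 2)))) ≤ β :=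
    le_trans (le_trans (le_trans (le_max_left _ _) (le_max_right _ _)) (le_max_right _ _)) hβ'
  have hT2 : (1 / ε) ^ (1 / (-(-(γc / 40)))) ≤ β :=
    le_trans (le_trans (le_trans (le_max_right _ _) (le_max_right _ _)) (le_max_right _ _)) hβ'
  have hβ1 : (1 : ℝ) ≤ β := le_trans (by norm_num) h200
  -- the rates `13 β^{−a/2} ≤ ε` and `β^{−γc/40} ≤ ε`
  have hr1 : 13 * β ^ (-(γc / 160 / 2)) ≤ ε := by
    have key : 13 / ε * β ^ (-(γc / 160 / 2)) ≤ 1 := mul_rpow_le_one_of_le (by positivity) (by linarith) hT1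
    have h := mul_le_mul_of_nonneg_left key hε.le
    calc 13 * β ^ (-(γc / 160 / 2)) = ε * (13 / ε * β ^ (-(γc / 160 / 2))) := by field_simp
      _ ≤ ε * 1 := h
      _ = ε := mul_one ε
  have hr2 : β ^ (-(γc / 40)) ≤ ε := by
    have key : 1 / ε * β ^ (-(γc / 40)) ≤ 1 := mul_rpow_le_one_of_le (by positivity) (by linarith) hT2
    have h := mul_le_mul_of_nonneg_left key hε.le
    calc β ^ (-(γc / 40)) = ε * (1 / ε * β ^ (-(γc / 40))) := by field_simp
      _ ≤ ε * 1 := h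
      _ = ε := mul_one ε
  -- the windows
  have hLw : (L : ℝ) ≤ β ^ (γc / 40) := hLa.trans (Real.rpow_le_rpow_of_exponent_le hβ1 (by linarith))
  -- the ring: `n = L - 1`, `n + 1 = L ≤ 2L`
  have hn1 : 1 ≤ L - 1 := by omega
  have hn2 : L - 1 + 1 ≤ 2 * L := by omega
  have hZ : physTrace L β L = physTraceSucc L β (L - 1) := rfl
  have hZ0 : 0 ≤ physTraceSucc L β (L - 1) := physTraceSucc_nonneg_of (L := L) hn1 h200
  -- the `x`-twisted sectors, both ring parities
  have hthin : ∀ n : ℕ, 1 ≤ n → n + 1 ≤ 2 * L → ∀ z : Fin 3 → Bool, z 0 = true →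
      sectorWeight (L := L) β n z (fun _ _ => (1 : ℝ)) ≤ 13 * β ^ (-(γc / 160 / 2)) * physTraceSucc L β n := by
    intro n hn1' hn2' z hz
    obtain ⟨q, rfl | rfl⟩ : ∃ q : ℕ, n = 1 + (q + q) ∨ n = 1 + (q + 1 + q) := ⟨(n - 1) / 2, by omega⟩
    · exact he β hβe L hLa q hn2' z hz
    · exact ho β hβo L hLa q hn2' z hz
  -- the band event
  have hA : MeasurableSet {U : GaugeConfig 3 L SU2 | 2 - β ^ (-γc) ≤ polDist U} :=
    measurableSet_le measurable_const measurable_polDist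
  have hFm : Measurable (uncurry fun (Us : Fin (L - 1 + 1) → GaugeConfig 3 L SU2) (_g : Site 3 L → SU2) =>
      {U : GaugeConfig 3 L SU2 | 2 - β ^ (-γc) ≤ polDist U}.indicator (fun _ => (1 : ℝ)) (Us 0)) :=
    measurable_uncurry_slice_zero (measurable_const.indicator hA)
  have hGm : Measurable (uncurry fun (_Us : Fin (L - 1 + 1) → GaugeConfig 3 L SU2) (_g : Site 3 L → SU2) => (1 : ℝ)) :=
    measurable_const
  rw [ringInsTrace_indicator_zero_eq_sum_sectorWeight β (L - 1) hA, hZ]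
  -- every sector carries at most `ε · Z_phys`
  have hsector : ∀ z : Fin 3 → Bool,
      sectorWeight β (L - 1) z (fun Us _ =>
        {U : GaugeConfig 3 L SU2 | 2 - β ^ (-γc) ≤ polDist U}.indicator (fun _ => (1 : ℝ)) (Us 0)) ≤
      ε * physTraceSucc L β (L - 1) := by
    intro z
    cases hz : z 0
    · -- no `x`-twist: the wide own-axis strip at the equator
      exact (hw β hβw L hLw (L - 1) hn1 hn2 z hz).trans (mul_le_mul_of_nonneg_right hr2 hZ0)
    · -- `x`-twist: the whole sector is small by flux reflection
      have hmono := sectorWeight_mono (L := L) β (L - 1) z (C := 1) hFm hGm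
        (fun Us _ => abs_indicator_one_le _ (Us 0)) (fun _ _ => by rw [abs_one])
        (fun Us _ => Set.indicator_apply_le' (fun _ => le_rfl) (fun _ => zero_le_one))
      exact hmono.trans ((hthin (L - 1) hn1 hn2 z hz).trans (mul_le_mul_of_nonneg_right hr1 hZ0))
  -- sum over the eight sectors
  have hsum := Finset.sum_le_sum fun z (_ : z ∈ (Finset.univ : Finset (Fin 3 → Bool))) => hsector z
  rw [Finset.sum_const, Finset.card_univ, Fintype.card_fun, Fintype.card_bool, Fintype.card_fin, nsmul_eq_mul] at hsum
  rw [show ((2 ^ 3 : ℕ) : ℝ) = 8 by norm_num] at hsum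
  have hε8 : (1 / 8 : ℝ) * (8 * (ε * physTraceSucc L β (L - 1))) = ε * physTraceSucc L β (L - 1) := by ring
  exact (mul_le_mul_of_nonneg_left hsum (by norm_num)).trans hε8.le

end Summit.QuantumFields.YangMills.Theorems.QuantileBitPurity

end
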